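import Literature.MathematicalPhysics.QuantumFieldTheory.Balaban1983to89.B9Eq190FlatCoercivityZdPer
import Literature.MathematicalPhysics.QuantumFieldTheory.Balaban1983to89.B9Eq316TowerFlatIsOneStep

/-!
# `Balaban1983to89.B9Eq315QtorusReadingZdPer` — [Balaban1985BackgroundPropagators] (3.15)–(3.16) p. 393 AT THE FLAT BACKGROUND ON THE TORUS READ ON `ℤᵈ`: THE NE9
# CHAIN'S ONE-STEP BOND AVERAGING `Q^{(Lᵏ)}(1)` IS THE JUNCTION'S `k`-FOLD `linCovIter L 1 · k` — bridge storey S3 (core), and with it [Balaban1984PropagatorsI] (1.90)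
# READ ENTIRELY IN THE N06 JUNCTION'S `ℤᵈ` LETTERS: for a `P`-periodic Hermitian `𝔸`-valued bond field `A`, `P = Lᵏ·n`,
# `γ·c₀·Σ|A|²_τ ≤ c₀·Σ|(D¹A)|²_τ + c₀·Σ|R(1)D¹*A|²_τ + a·c₁·Σ_κΣ_{y∈[0,n)ᵈ}|L⁻ᵏ·(linCovIter L 1 A k)(y)_κ|²_τ`, `γ = (1∕((d+1)·Cst d 1))·min(a·c₁∕(c₀·Lᵏᵈ), 1)`

statement-level skeleton of published theorems with citation tags; proofs where landed; nothing here is a claim about the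
Yang–Mills mass gap

`[Balaban1985BackgroundPropagators]` ("B9", CMP **99** (1985) 389–434) (3.15) p. 393 *«Q_j(U) = Q(Ū^{j−1})…Q(Ū)Q(U)»*, (3.16) p. 393 *«⟨A, Q*aQA⟩ = Σ_{j=0}^{k} a
Σ_{b∈Λ_j} (L^jη)^{d−2} |(Q_j(U)A)(b)|²»*; `[Balaban1985Averaging]` ("B7") (122) p. 36 (the linear part of the averaging), (127) p. 37, p. 39 *«A composition of
k operators Q is the operator Q_k.»*; `[Balaban1984PropagatorsI]` ("B5") Prop. 1.1 (1.90) p. 33, (1.18) p. 20.  PDF held: via the tree's `B9Eq315QTorus` ∕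
`B9Eq316TowerFlatIsOneStep` ∕ `B5Eq190FlatCoercivitySpacingUniform` docstrings (re-read 2026-08-28).

CITATION HEADER (lean-in-tree rule).  Cell `pub-ymgap` (YM Track A, HUMAN RULINGS D-0062 ∕ D-0149), node N06 = [B9], width seat `pub-ymgap-dag-n06-w3` (g6),
bridge storey S3-core (LOCATED-BRIDGE bus 2026-08-28 14:27Z; memo `HOME/pub-ymgap-dag-n06-w3/BRIDGE-NE9-PERIODIC-g6.md`).  WHY.  Storey S4-partial
(`B9Eq190FlatCoercivityZdPer.flat_coercive_periodic_herm`) reads N02's (1.90) on the N06 periodic carrier with the `Q`-square still in the NE9 currency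
`‖QtorusW (Lᵏ) (n,…,n) … 1 x_A‖²`.  THIS FILE reads that square on `ℤᵈ`: the one-step NE9 averaging at block `Lᵏ` and the flat background IS, after the
fibre coordinates, `L⁻ᵏ·linCovIter L 1 A k` — `B7Prop4GeneralLevels.linCovIter`, the un-normalised composite (127) from which dag-n06-b's genuine `Q*aQ`
letter `QQZdP` (`clsField`, `linCovIterT`) is built — by the NE9 chain's own flat identities `B9Eq316TowerFlatIsOneStep.linCovIter_one_left`,
`B7Prop4Flat.linQIter_eq_linQ_pow`, `B7Prop3GeneralLinear.linQcov_one_left`.  The remaining step to dag-n06-b's `⟨A, QQZdP(1)A⟩_per` is the transpose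
identity of `linCovIterT` on the period cell (dag-n06-b's letters; not here).

WHAT IS PROVED (kernel, 0 sorry, 0 def).
* §1 ★★ `read_QtorusW_one_pow` (`φ((Q^{(Lᵏ)}(1)x)(y, κ)) = (Lᵏ)⁻¹ • linCovIter L 1 A k (liftSite y) κ`, `A` the reading of `x`), ★ `norm_sq_QtorusW_one_pow_read`
  (`‖Q^{(Lᵏ)}(1)x‖²_{c₁} = c₁·Σ_κΣ_{y∈[0,n)ᵈ} Re τ|L⁻ᵏ·linCovIter L 1 A k y κ|²`).
* §2 ★★★ `flat_coercive_periodic_herm_zd` ([B5] (1.90) READ ENTIRELY IN `ℤᵈ` LETTERS — statement in the header; `D*D`-square = the RHS of dag-n06-b's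
  `sum_box_pair_Jcur`, `R`-square through dag-n06-w4's `projRPer`, `Q`-square through `linCovIter L 1 A k`).

HONEST SCOPE.  Count-neutral helper (`--supports` the K1 item of record): an IMPORT of N02's kernel-certified (1.90) through the NE9 chain and this seat's bridge —
explicit constant, no new estimate; flat background, one averaging level (the torus datum `Λ_k = T`), the identification of the `Q`-square with dag-n06-b's
`⟨A, QQZdP(1)A⟩_per` (transpose identity, weights `wQ_k`) NOT here; Thm 3.11 ∕ 3.3 at `U₀ ≠ 1` NOT proved; N05 ∕ N06 NOT discharged; K1 NOT closed; one finite `𝕋⁴`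
programme at fixed `ε`, Bałaban as printed; R4 closes only the conditional finite-`𝕋⁴` rung `BalabanLadder.UV` — nothing continuum ∕ ℝ⁴ ∕ OS ∕ mass gap ∕ Clay.
Unit `pub-ymgap-dag-n06-w3` (g6), 2026-08-28; NEW file importing `B9Eq190FlatCoercivityZdPer` and `B9Eq316TowerFlatIsOneStep`; modifies nothing.
Net new unproved facts: 0.
-/

noncomputable section

open scoped BigOperators InnerProductSpace ComplexConjugate

namespace Literature.MathematicalPhysics.QuantumFieldTheory.Balaban1983to89.B9Eq315QtorusReadingZdPer

open B4Sect5Torus (TSite)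
open B9SectCLatticeCarrier (Bond)
open B9Eq311L2Pairing (WL2)
open B11Eq103H1Complex (BondL2K)
open B9Eq315QTorus (perSite perCfg perCfg_apply cornerSite QtorusW QtorusW_apply QtorusLin_apply)
open B9Eq315QTorusOnto (liftSite perSite_liftSite)
open B9Eq319QprimeTorus (fineP)
open B5Eq172FlatCoercivity (hU1_one hreg_one)
open B5Eq155FlatAveragingCommute (norm_perCfg_le)
open B7Prop3GeneralLinear (linQcov linQcov_one_left)
open B7Prop4Flat (linQIter linQIter_eq_linQ_pow)
open B7Prop4GeneralLevels (linCovIter)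
open B9Eq316TowerFlatIsOneStep (linCovIter_one_left)
open B8Eq146AExpansion (plaqCovDeriv)
open B8Eq138LandauZd (covDivB)
open T4TermwiseTorus (IsPeriodic box)
open B9Eq321LandauProjectionZdPer (projRPer)
open B9Eq315PeriodicReadingZdPer (sum_box_eq_sum_univ_liftSite)
open B9Eq319QprimeReadingZdPer (cornerSite_eq_smul_liftSite)
open B9Eq190FlatCoercivityZdPer (norm_sq_fibre_eq_re_trace flat_coercive_read_mixed)

variable {d : ℕ}

/-! ## §1  NE9's one-step `Q^{(Lᵏ)}(1)` read on `ℤᵈ` is `L⁻ᵏ·linCovIter L 1 · k` -/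

section QRead

variable (L : ℕ) [NeZero L] (k n : ℕ) [NeZero n] {𝔸 : Type*} [CStarAlgebra 𝔸] [Nontrivial 𝔸] (τ : 𝔸 →ₗ[ℂ] ℂ) {n' : ℕ} {c₀ c₁ : ℝ}
  [Fact (0 < c₀)] [Fact (0 < c₁)] (φ : EuclideanSpace ℂ (Fin n') ≃ₗ[ℂ] 𝔸)

omit [Fact (0 < c₀)] [Fact (0 < c₁)] in
/-- ★★ **NE9's ONE-STEP BOND AVERAGING AT BLOCK `Lᵏ` AND THE FLAT BACKGROUND, READ ON `ℤᵈ`, IS `L⁻ᵏ·linCovIter L 1 · k`**: for `x` in the NE9 bond space on the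
fine torus of periods `Lᵏ·n` with reading `A(w)_μ = φ(x(w̄, μ))`, the coarse value `φ((Q^{(Lᵏ)}(1)x)(y, κ))` is `(Lᵏ)⁻¹ • linCovIter L 1 A k (liftSite y) κ`
([B7] p. 39 «a composition of k operators Q is the operator Q_k», at `U₀ = 1`: `B9Eq316TowerFlatIsOneStep.linCovIter_one_left` + `B7Prop4Flat.linQIter_eq_linQ_pow` +
`B7Prop3GeneralLinear.linQcov_one_left`). [cite: Balaban1985BackgroundPropagators, (3.15) p.393; Balaban1985Averaging, (122) p.36, (127) p.37, p.39; Balaban1984PropagatorsI, (1.18) p.20] -/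
theorem read_QtorusW_one_pow (hL : 1 ≤ L) (x : BondL2K ℂ d (fineP (L ^ k) (fun _ : Fin d => n)) c₀ (EuclideanSpace ℂ (Fin n')))
    (y : TSite d (fun _ : Fin d => n)) (κ : Fin d) :
    φ (WL2.equiv ℂ _ _ (QtorusW (L ^ k) (fun _ : Fin d => n) (Nat.one_le_pow k L hL) φ (fun _ => (1 : 𝔸ˣ)) (α := 0) (by norm_num)
        (hU1_one (L ^ k) (fun _ : Fin d => n)) (hreg_one (L ^ k) (fun _ : Fin d => n)) (c₁ := c₁) x) (y, κ)) =
      (((L : ℂ) ^ k))⁻¹ • linCovIter L (1 : B7Prop1Explicit.Site d → Fin d → 𝔸ˣ)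
        (fun w μ => φ (WL2.equiv ℂ _ _ x (perSite (fineP (L ^ k) (fun _ : Fin d => n)) w, μ))) k (liftSite y) κ := by
  -- the reading and its bound
  set B : B7Prop1Explicit.Site d → Fin d → 𝔸 := perCfg (fineP (L ^ k) (fun _ : Fin d => n)) (fun b => φ (WL2.equiv ℂ _ _ x b)) with hB
  have hBeq : (fun w μ => φ (WL2.equiv ℂ _ _ x (perSite (fineP (L ^ k) (fun _ : Fin d => n)) w, μ))) = B := by
    funext w μ; rw [hB, perCfg_apply]
  have hb : 0 ≤ ∑ b : Bond d (fineP (L ^ k) (fun _ : Fin d => n)), ‖φ (WL2.equiv ℂ _ _ x b)‖ := Finset.sum_nonneg fun _ _ => norm_nonneg _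
  have hBb : ∀ w μ, ‖B w μ‖ ≤ ∑ b : Bond d (fineP (L ^ k) (fun _ : Fin d => n)), ‖φ (WL2.equiv ℂ _ _ x b)‖ :=
    fun w μ => norm_perCfg_le (fun b => φ (WL2.equiv ℂ _ _ x b)) w μ
  have h1 : perCfg (fineP (L ^ k) (fun _ : Fin d => n)) (fun _ : Bond d (fineP (L ^ k) (fun _ : Fin d => n)) => (1 : 𝔸ˣ)) = 1 := rfl
  have hLk : 1 ≤ L ^ k := Nat.one_le_pow k L hL
  rw [QtorusW_apply, LinearEquiv.apply_symm_apply, QtorusLin_apply, h1, ← hB, hBeq,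
    linQcov_one_left (L ^ k) hLk B hb hBb, cornerSite_eq_smul_liftSite, ← linQIter_eq_linQ_pow L B k (liftSite y) κ,
    ← linCovIter_one_left L hL B hb hBb k, Nat.cast_pow]

omit [Fact (0 < c₀)] in
include τ in
/-- ★ **THE `Q`-SQUARE READ ON `ℤᵈ`**: `‖Q^{(Lᵏ)}(1)x‖²_{c₁} = c₁·Σ_κ Σ_{y∈[0,n)ᵈ} Re τ|L⁻ᵏ·(linCovIter L 1 A k)(y)_κ|²` for a τ-isometric `φ`.
[cite: Balaban1985BackgroundPropagators, (3.15)–(3.16) p.393; Balaban1985Averaging, (127) p.37] -/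
theorem norm_sq_QtorusW_one_pow_read (hφ : ∀ x y : EuclideanSpace ℂ (Fin n'), τ (star (φ x) * φ y) = ⟪x, y⟫_ℂ) (hL : 1 ≤ L)
    (x : BondL2K ℂ d (fineP (L ^ k) (fun _ : Fin d => n)) c₀ (EuclideanSpace ℂ (Fin n'))) :
    ‖QtorusW (L ^ k) (fun _ : Fin d => n) (Nat.one_le_pow k L hL) φ (fun _ => (1 : 𝔸ˣ)) (α := 0) (by norm_num)
        (hU1_one (L ^ k) (fun _ : Fin d => n)) (hreg_one (L ^ k) (fun _ : Fin d => n)) (c₁ := c₁) x‖ ^ 2 =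
      c₁ * ∑ κ : Fin d, ∑ y ∈ box (d := d) n,
        (τ (star ((((L : ℂ) ^ k))⁻¹ • linCovIter L (1 : B7Prop1Explicit.Site d → Fin d → 𝔸ˣ)
                (fun w μ => φ (WL2.equiv ℂ _ _ x (perSite (fineP (L ^ k) (fun _ : Fin d => n)) w, μ))) k y κ) *
            ((((L : ℂ) ^ k))⁻¹ • linCovIter L (1 : B7Prop1Explicit.Site d → Fin d → 𝔸ˣ)
                (fun w μ => φ (WL2.equiv ℂ _ _ x (perSite (fineP (L ^ k) (fun _ : Fin d => n)) w, μ))) k y κ))).re := by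
  rw [WL2.norm_sq, Fintype.sum_prod_type, Finset.mul_sum, Finset.sum_comm]
  refine Finset.sum_congr rfl fun κ _ => ?_
  rw [Finset.mul_sum, sum_box_eq_sum_univ_liftSite n]
  refine Finset.sum_congr rfl fun y _ => ?_
  rw [norm_sq_fibre_eq_re_trace τ φ hφ, read_QtorusW_one_pow L k n φ hL x y κ]

end QRead

/-! ## §2  [B5] (1.90) read entirely in the junction's `ℤᵈ` letters -/

section Coercive

variable (L : ℕ) [NeZero L] (k n : ℕ) [NeZero n] {𝔸 : Type*} [CStarAlgebra 𝔸] [Nontrivial 𝔸] [FiniteDimensional ℝ 𝔸]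
  (τ : 𝔸 →ₗ[ℂ] ℂ) {n' : ℕ} {c₀ c₁ : ℝ} [Fact (0 < c₀)] [Fact (0 < c₁)] (η a : ℝ)
  (φ : EuclideanSpace ℂ (Fin n') ≃ₗ[ℂ] 𝔸)

/-- ★★★ **[B5] PROP. 1.1 (1.90) FOR THE GENUINE FOUR-LETTER FLAT FORM OF THE N06 JUNCTION ON `T_P`, IN `ℤᵈ` LETTERS**: for a `P`-periodic HERMITIAN `𝔸`-valued
bond field `A` on `ℤᵈ` (`P = Lᵏ·n`), `0 < η`, `η·Lᵏ ≤ 1`, `0 < a`, τ Hermitian ∕ faithful ∕ tracial, a τ-isometric `φ` (`B9HilbertSchmidtFibreCoordinates`),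
`Λs k = univ`, `Λs j = ∅` (`j < k`):
`γ·c₀·Σ_μΣ_{z∈[0,P)ᵈ} Re τ(A*A) ≤ c₀·Σ_κΣ_{ν<κ}Σ_{[0,P)ᵈ} Re τ|(plaqCovDeriv η 1 A)_{νκ}|² + c₀·Σ_{[0,P)ᵈ} Re τ|projRPer τ P L k η Λs 1 (covDivB η 1 A)|² +
 a·c₁·Σ_κΣ_{y∈[0,n)ᵈ} Re τ|L⁻ᵏ·(linCovIter L 1 A k)(y)_κ|²`, `γ = (1∕((d+1)·B5Prop11Plancherel.Cst d 1))·min(a·c₁∕(c₀·(Lᵏ)ᵈ), 1)` — N02's kernel-certified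
(1.90) transported by the pub-balaban NE9 chain and read through storeys S1 (`D`), S2 (`R`), S3 (`Q`), S4-fibre (`φ`) of this seat's bridge.
[cite: Balaban1984PropagatorsI, Prop. 1.1 (1.90) p.33, (1.69) p.29; Balaban1985BackgroundPropagators, (3.26) p.395, (3.16) p.393, Thm 3.11 p.416] -/
theorem flat_coercive_periodic_herm_zd (hτs : ∀ b : 𝔸, τ (star b) = starRingEnd ℂ (τ b)) (hτp : ∀ b : 𝔸, b ≠ 0 → 0 < (τ (star b * b)).re)
    (hτt : ∀ b b' : 𝔸, τ (b * b') = τ (b' * b)) (hφ : ∀ x y : EuclideanSpace ℂ (Fin n'), τ (star (φ x) * φ y) = ⟪x, y⟫_ℂ) (hL : 1 ≤ L)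
    (hη0 : 0 < η) (hηL : η * (L ^ k : ℕ) ≤ 1) (ha : 0 < a)
    (Λs : ℕ → Set (B7Prop1Explicit.Site d)) (hΛk : Λs k = Set.univ) (hΛlt : ∀ j, j < k → Λs j = ∅)
    {A : B7Prop1Explicit.Site d → Fin d → 𝔸} (hAper : IsPeriodic (L ^ k * n) A) (hAherm : ∀ w μ, IsSelfAdjoint (A w μ)) :
    (1 / ((d + 1 : ℝ) * B5Prop11Plancherel.Cst d 1)) * min (a * c₁ / (c₀ * ((L ^ k : ℕ) : ℝ) ^ d)) 1 *
        (c₀ * ∑ μ : Fin d, ∑ z ∈ box (d := d) (L ^ k * n), (τ (star (A z μ) * A z μ)).re) ≤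
      c₀ * (∑ κ : Fin d, ∑ ν ∈ Finset.Iio κ, ∑ z ∈ box (d := d) (L ^ k * n),
          (τ (star (plaqCovDeriv η (1 : B7Prop1Explicit.Site d → Fin d → 𝔸ˣ) A ν κ z) *
            plaqCovDeriv η (1 : B7Prop1Explicit.Site d → Fin d → 𝔸ˣ) A ν κ z)).re) +
      c₀ * (∑ z ∈ box (d := d) (L ^ k * n),
          (τ (star (projRPer τ (L ^ k * n) L k η Λs (1 : B7Prop1Explicit.Site d → Fin d → 𝔸ˣ)
                (covDivB η (1 : B7Prop1Explicit.Site d → Fin d → 𝔸ˣ) A) z) *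
              projRPer τ (L ^ k * n) L k η Λs (1 : B7Prop1Explicit.Site d → Fin d → 𝔸ˣ)
                (covDivB η (1 : B7Prop1Explicit.Site d → Fin d → 𝔸ˣ) A) z)).re) +
      a * (c₁ * ∑ κ : Fin d, ∑ y ∈ box (d := d) n,
          (τ (star ((((L : ℂ) ^ k))⁻¹ • linCovIter L (1 : B7Prop1Explicit.Site d → Fin d → 𝔸ˣ) A k y κ) *
              ((((L : ℂ) ^ k))⁻¹ • linCovIter L (1 : B7Prop1Explicit.Site d → Fin d → 𝔸ˣ) A k y κ))).re) := by
  -- the torus function read by `A`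
  set x : BondL2K ℂ d (fineP (L ^ k) (fun _ : Fin d => n)) c₀ (EuclideanSpace ℂ (Fin n')) :=
    (WL2.equiv ℂ (fun _ : Bond d (fineP (L ^ k) (fun _ : Fin d => n)) => c₀) (EuclideanSpace ℂ (Fin n'))).symm
      fun b => φ.symm (A (liftSite b.1) b.2) with hx
  have hread : (fun w μ => φ (WL2.equiv ℂ _ _ x (perSite (fineP (L ^ k) (fun _ : Fin d => n)) w, μ))) = A := by
    funext w μ
    rw [hx, Equiv.apply_symm_apply, LinearEquiv.apply_symm_apply]
    exact B9Eq315PeriodicReadingZdPer.comp_perSite_liftSite_restrict (L ^ k * n) (B9Eq327GreenZdHermPer.isPeriodic_apply_dir hAper μ) w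
  have hread' : ∀ (w : B7Prop1Explicit.Site d) (μ : Fin d), φ (WL2.equiv ℂ _ _ x (perSite (fineP (L ^ k) (fun _ : Fin d => n)) w, μ)) = A w μ :=
    fun w μ => congr_fun (congr_fun hread w) μ
  have hHerm : ∀ (w : B7Prop1Explicit.Site d) (μ : Fin d), IsSelfAdjoint (φ (WL2.equiv ℂ _ _ x (perSite (fineP (L ^ k) (fun _ : Fin d => n)) w, μ))) :=
    fun w μ => by rw [hread' w μ]; exact hAherm w μ
  have h := flat_coercive_read_mixed L k n τ η a φ (c₁ := c₁) hτs hτp hτt hφ hL hη0 hηL ha Λs hΛk hΛlt x hHerm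
  rw [norm_sq_QtorusW_one_pow_read L k n τ φ (c₁ := c₁) hφ hL x] at h
  simp only [hread'] at h
  exact h

end Coercive

end Literature.MathematicalPhysics.QuantumFieldTheory.Balaban1983to89.B9Eq315QtorusReadingZdPer

end
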